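import Mathlib
import HarnessLib
import Summits.HubbardSuperconductivity.HubbardSuperconductivity.Theorems.KLProgrammeKLRegimeEngineFrameShiftSymbolMoments

/-!
# K3 gen-8-FLOW (stmt 20437 `KLRegimeEngineV17F2`, stub (C), door (B)): the symbol-difference moments from the FRAME JET TABLES
# (`‖Dʲ evalM K₀‖ ≤ κ_j`, `‖Dʲ(evalM K₁ − evalM K₀)‖ ≤ W_j`) — the consumer-facing form of `frameShift_symbol_moment_le`

Cell gate-hubbard-kl, seat p2 g11.  `…EngineFrameShiftSymbolMoments.frameShift_symbol_moment_le` (p541228) reads the interpolated frame BANDS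
`e_{K₀} + s(e_{K₁} − e_{K₀})`; the flow-frame tables are about the FRAMES (`FlowPieceJetsAt`: `‖Dʲ evalM (klFlowPiece m)‖`, and at orders `5, 6`
`…FlowPieceJetsAllOrders`).  Since `e_K = (ε − μ) − evalM K` (`frameLevel μ K = frameLevel μ 0 + frameShift K`) and `‖Dʲ(ε − μ)‖ ≤ 4` for `j ≥ 1`
(`norm_iteratedFDeriv_frameLevel_zero_le`), the band hypotheses follow from frame-jet tables `κ`, `W` and ONE arithmetic fit
`4 + κ_j + W_j ≤ d·(6/m)^{j−1}` (`1 ≤ j ≤ r + 2`):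

* `frameLevel_eq_zero_sub_evalM` — `e_K(q) = e_0(q) − evalM K q`;
* `norm_iteratedFDeriv_frameBandInterp_le_of_frameJets` — `‖Dʲ(e_{K₀} + s(e_{K₁} − e_{K₀}))(q)‖ ≤ 4 + κ_j + W_j` (`1 ≤ j`, `s ∈ [0,1]`);
* `norm_iteratedFDeriv_frameBandDiff_eq` — `‖Dʲ(e_{K₁} − e_{K₀})(q)‖ = ‖Dʲ(evalM K₁ − evalM K₀)(q)‖`;
* **`frameShift_symbol_moment_le_of_frameJets`** — the moments `Σ_x (1+|x̃₀|+|x̃₁|)^r‖𝔉⁻¹[k⃗ ↦ Ψ_{K₁} − Ψ_{K₀}](x)‖ ≤ 21·3^r·𝒥` from `κ`, `W`, the fit, and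
  `𝒥 ≥ (π/2)^k·Σ_{j≤k} C(k,j)(j!(A·j!)(max(d,1)·6/m)ʲ)W_{k−j}` (`k ≤ r+2`), `A = 2βL²B(2/m)²`, `m = max(|ω_i|, Λ/2)`.
  For `(K₀, K₁) = (K_n, K_{n+1})`: `evalM K₁ − evalM K₀ = −evalM (klFlowPiece n)` (`klFlowFrameU_succ`, `evalM_fsub`), `W_j` = the piece tables,
  `κ_j ≤ Σ_{m<n}` piece tables.

Proofs only; nothing about the sizes is asserted; nothing asserts superconductivity.  References: BGM 2006 §2.1 (2.36aa), §3 (3.2)–(3.8)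
[cite: BenfattoGiulianiMastropietro2006].
-/

noncomputable section

namespace Summit.HubbardSuperconductivity.HubbardSuperconductivity.Theorems.EngineV8

set_option linter.dupNamespace false -- summit = problem name (single-conjunct summit), D-0017

open Finset Literature.MathematicalPhysics.QuantumLattice Literature.Probability.LatticeModels Set
open Summit.HubbardSuperconductivity.HubbardSuperconductivity.Theorems.KLRegimeSplit
open Summit.HubbardSuperconductivity.HubbardSuperconductivity.Theorems.DispersionFlow
open scoped Nat

variable {L M : ℕ} [NeZero L]

/-! ## §1 Frame bands from frames -/

omit [NeZero L] in
/-- `e_K(q) = e_0(q) − evalM K q`. -/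
theorem frameLevel_eq_zero_sub_evalM (μ : ℝ) (K : TrigPolyC4v) (q : Momentum) : frameLevel μ K q = frameLevel μ 0 q - evalM K q := by
  simp [frameLevel, evalM]

omit [NeZero L] in
/-- **The interpolated band's jets from frame jets**: `‖Dʲ(e_{K₀} + s(e_{K₁} − e_{K₀}))(q)‖ ≤ 4 + κ_j + W_j` for `1 ≤ j`, `s ∈ [0,1]`, whenever
`‖Dʲ evalM K₀ (q)‖ ≤ κ_j` and `‖Dʲ(evalM K₁ − evalM K₀)(q)‖ ≤ W_j`. -/
theorem norm_iteratedFDeriv_frameBandInterp_le_of_frameJets (μ : ℝ) (K₀ K₁ : TrigPolyC4v) {j : ℕ} (hj : 1 ≤ j) {s : ℝ} (hs : s ∈ Icc (0 : ℝ) 1)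
    {κ W : ℝ} (hK₀ : ∀ q : Momentum, ‖iteratedFDeriv ℝ j (evalM K₀) q‖ ≤ κ)
    (hW : ∀ q : Momentum, ‖iteratedFDeriv ℝ j (fun q => evalM K₁ q - evalM K₀ q) q‖ ≤ W) (q : Momentum) :
    ‖iteratedFDeriv ℝ j (fun q => frameLevel μ K₀ q + s * (frameLevel μ K₁ q - frameLevel μ K₀ q)) q‖ ≤ 4 + κ + W := by
  have hfun : (fun q => frameLevel μ K₀ q + s * (frameLevel μ K₁ q - frameLevel μ K₀ q)) =
      fun q => frameLevel μ 0 q + ((-1 : ℝ) • evalM K₀ q + (-s) • (evalM K₁ q - evalM K₀ q)) := by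
    funext q
    rw [frameLevel_eq_zero_sub_evalM μ K₀, frameLevel_eq_zero_sub_evalM μ K₁]
    simp only [smul_eq_mul]
    ring
  have hA : ContDiff ℝ j (frameLevel μ 0) := contDiff_frameLevel μ 0
  have hB : ContDiff ℝ j (fun q : Momentum => (-1 : ℝ) • evalM K₀ q) := (contDiff_evalM K₀).const_smul _
  have hD0 : ContDiff ℝ j (fun q : Momentum => evalM K₁ q - evalM K₀ q) := (contDiff_evalM K₁).sub (contDiff_evalM K₀)
  have hC : ContDiff ℝ j (fun q : Momentum => (-s) • (evalM K₁ q - evalM K₀ q)) := hD0.const_smul _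
  have hBC : ContDiff ℝ j (fun q : Momentum => (-1 : ℝ) • evalM K₀ q + (-s) • (evalM K₁ q - evalM K₀ q)) := hB.add hC
  rw [hfun, fun_iteratedFDeriv_add_apply hA.contDiffAt hBC.contDiffAt, fun_iteratedFDeriv_add_apply hB.contDiffAt hC.contDiffAt,
    iteratedFDeriv_const_smul_apply' (contDiff_evalM K₀).contDiffAt, iteratedFDeriv_const_smul_apply' hD0.contDiffAt]
  have h0 := norm_iteratedFDeriv_frameLevel_zero_le μ hj q
  have hs1 : |s| ≤ 1 := by rw [abs_of_nonneg hs.1]; exact hs.2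
  have hW0 : 0 ≤ W := (norm_nonneg _).trans (hW q)
  calc ‖iteratedFDeriv ℝ j (frameLevel μ 0) q + ((-1 : ℝ) • iteratedFDeriv ℝ j (evalM K₀) q +
        (-s) • iteratedFDeriv ℝ j (fun q => evalM K₁ q - evalM K₀ q) q)‖
      ≤ ‖iteratedFDeriv ℝ j (frameLevel μ 0) q‖ + (‖(-1 : ℝ) • iteratedFDeriv ℝ j (evalM K₀) q‖ +
        ‖(-s) • iteratedFDeriv ℝ j (fun q => evalM K₁ q - evalM K₀ q) q‖) := (norm_add_le _ _).trans (add_le_add le_rfl (norm_add_le _ _))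
    _ ≤ 4 + (κ + W) := by
        refine add_le_add h0 (add_le_add ?_ ?_)
        · rw [norm_smul, Real.norm_eq_abs, abs_neg, abs_one, one_mul]; exact hK₀ q
        · rw [norm_smul, Real.norm_eq_abs, abs_neg]
          calc |s| * ‖iteratedFDeriv ℝ j (fun q => evalM K₁ q - evalM K₀ q) q‖ ≤ 1 * W :=
                mul_le_mul hs1 (hW q) (norm_nonneg _) zero_le_one
            _ = W := one_mul W
    _ = 4 + κ + W := by ring

omit [NeZero L] in
/-- **The band difference is minus the frame difference**: `‖Dʲ(e_{K₁} − e_{K₀})(q)‖ = ‖Dʲ(evalM K₁ − evalM K₀)(q)‖`. -/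
theorem norm_iteratedFDeriv_frameBandDiff_eq (μ : ℝ) (K₀ K₁ : TrigPolyC4v) (j : ℕ) (q : Momentum) :
    ‖iteratedFDeriv ℝ j (fun q => frameLevel μ K₁ q - frameLevel μ K₀ q) q‖ =
      ‖iteratedFDeriv ℝ j (fun q => evalM K₁ q - evalM K₀ q) q‖ := by
  have hfun : (fun q => frameLevel μ K₁ q - frameLevel μ K₀ q) = fun q => (-1 : ℝ) • (evalM K₁ q - evalM K₀ q) := by
    funext q
    rw [frameLevel_eq_zero_sub_evalM μ K₀, frameLevel_eq_zero_sub_evalM μ K₁, smul_eq_mul]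
    ring
  have hD0 : ContDiff ℝ j (fun q : Momentum => evalM K₁ q - evalM K₀ q) := (contDiff_evalM K₁).sub (contDiff_evalM K₀)
  rw [hfun, iteratedFDeriv_const_smul_apply' hD0.contDiffAt, norm_smul, Real.norm_eq_abs, abs_neg, abs_one, one_mul]

/-! ## §2 The moments from the frame jet tables -/

/-- **THE SYMBOL-DIFFERENCE MOMENTS FROM THE FRAME JET TABLES** (consumer-facing form of `frameShift_symbol_moment_le`): with `m = max(|ω_i|, Λ/2)`,
`A = 2βL²B(2/m)²`, frames `K₀, K₁` with `‖Dʲ evalM K₀‖ ≤ κ_j` (`1 ≤ j ≤ r+2`), `‖Dʲ(evalM K₁ − evalM K₀)‖ ≤ W_j` (`j ≤ r+2`), the fit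
`4 + κ_j + W_j ≤ d·(6/m)^{j−1}` (`1 ≤ j ≤ r+2`), cutoff derivatives `≤ B` to order `N ≥ r+4`, and
`(π/2)^k·Σ_{j≤k} C(k,j)·(j!·(A·j!)·(max(d,1)·6/m)ʲ)·W_{k−j} ≤ 𝒥` (`k ≤ r+2`):
`Σ_x (1+|x̃₀|+|x̃₁|)^r·‖𝔉⁻¹[k⃗ ↦ Ψ_{K₁}((ω_i,k⃗),σ) − Ψ_{K₀}((ω_i,k⃗),σ)](x)‖ ≤ 21·3^r·𝒥`. -/
theorem frameShift_symbol_moment_le_of_frameJets {β : ℝ} (hβ : 0 < β) {Λ : ℝ} (hΛ : 0 < Λ) {N : ℕ} {B : ℝ} (hB1 : 1 ≤ B)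
    (hB : ∀ i ≤ N, ∀ t, ‖iteratedDeriv i salmhoferCutoff t‖ ≤ B) (r : ℕ) (hN : r + 4 ≤ N) (μ : ℝ) (K₀ K₁ : TrigPolyC4v)
    (i : MatsubaraIdx M) (σ : Fin 2) {κ W : ℕ → ℝ}
    (hK₀ : ∀ j, 1 ≤ j → j ≤ r + 2 → ∀ q : Momentum, ‖iteratedFDeriv ℝ j (evalM K₀) q‖ ≤ κ j)
    (hW : ∀ j ≤ r + 2, ∀ q : Momentum, ‖iteratedFDeriv ℝ j (fun q => evalM K₁ q - evalM K₀ q) q‖ ≤ W j)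
    {d : ℝ} (hfit : ∀ j, 1 ≤ j → j ≤ r + 2 → 4 + κ j + W j ≤ d * (6 / max |matsubaraFreq β M i| (Λ / 2)) ^ (j - 1))
    {J : ℝ}
    (hJ : ∀ k ≤ r + 2, (Real.pi / 2) ^ k * ∑ j ∈ Finset.range (k + 1), (k.choose j : ℝ) *
      (j ! * ((2 * (β * (L : ℝ) ^ 2) * B * (2 / max |matsubaraFreq β M i| (Λ / 2)) ^ 2) * j !) *
        (max d 1 * (6 / max |matsubaraFreq β M i| (Λ / 2))) ^ j) * W (k - j) ≤ J) :
    ∑ x : TorusSite 2 L, (1 + ((x 0).valMinAbs.natAbs : ℝ) + ((x 1).valMinAbs.natAbs : ℝ)) ^ r *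
        ‖torusFourierInv (fun kv : TorusSite 2 L => uvSymbolCT L M β μ K₁ Λ ((i, kv), σ) - uvSymbolCT L M β μ K₀ Λ ((i, kv), σ)) x‖ ≤
      21 * 3 ^ r * J := by
  refine frameShift_symbol_moment_le hβ hΛ hB1 hB r hN μ K₀ K₁ i σ (d := d) (fun s hs j hj1 hj2 q => ?_) (W := W) (fun j hj q => ?_) hJ
  · exact (norm_iteratedFDeriv_frameBandInterp_le_of_frameJets μ K₀ K₁ hj1 hs (hK₀ j hj1 hj2) (hW j hj2) q).trans (hfit j hj1 hj2)
  · rw [norm_iteratedFDeriv_frameBandDiff_eq]; exact hW j hj q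

end Summit.HubbardSuperconductivity.HubbardSuperconductivity.Theorems.EngineV8

end
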